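import Literature.AnabelianGeometry.SemiGraphs.TemperedTopCyclicLocalTransportSameImage
import Literature.AnabelianGeometry.SemiGraphs.TreeSystemClosedBaseWalkTransport
import HarnessLib

/-!
# [SemiAnbd] Thm 3.7 (iii) / Cor 3.9 (R3c) for TOPOLOGICALLY CYCLIC edge groups on an ARBITRARY `𝔾`:
# a fixed branch is transported back along any fixed tree path whose two ends have the same image at a
# lower level, keeping its image there (proof-only)

Mochizuki, *Semi-graphs of anabelioids*, Publ. RIMS **42** (2006), §3 Theorem 3.7 (iii), proof p. 41,
third paragraph, with the author's *Comments* (2020) (6)(b); Corollary 3.9, proof p. 43 l. 13 (the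
cell's step (R3c), FACT-LIST rows F-2772 `EdgeLikeCentralizerAt` / F-2773 `EdgeLikeCentralizer`)
[cite: MochizukiSemiAnbd2006, Thm 3.7(iii) p.41].

PROOF-ONLY (cell abc-iut, block F, seat abc-iut-f-172 gen 7; brick (B⁺) of «(R3c)@TOP-CYCLIC-CORE»; no
definition, no named fact).  **CROSS-LEVEL PATH TRANSPORT** (`exists_fixed_branch_of_sameImage_path`):
in a Galois tower over a `𝒢` ALL of whose edge groups are topologically cyclic — NO hypothesis on the
underlying semi-graph `𝔾` (cycles, loops, infinitely-branching cores allowed) — let `j ≤ n`, let `p` be a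
path of the subdivision of `𝔾̃_n` from a vertex `a` to a vertex `z` having THE SAME IMAGE in `𝔾̃_j`,
every node of which is fixed by the subgroup `C` of `π₁^temp(𝒢)`, and let `δ` be a branch at `z` with
`C`-fixed edge.  Then `C` fixes the edge of a branch AT `a` whose image in `𝔾̃_j` is that of `δ` (in
particular it lies over the same base branch).  This is abc-iut-f-175 gen 3's brick (B)
(`exists_fixed_branch_of_closed_baseWalk`, acyclic BASE) with the base replaced by the TREE `𝔾̃_j`: by
strong induction on the length, the FIRST return of `p` to a vertex with the image of `a` happens
through a branch with the same `𝔾̃_j`-image as the first step (in the tree `𝔾̃_j` the point of the image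
vertex separates its branch-points: abc-iut-f-175's `SemiGraph.branch_eq_of_walk_avoiding_vertex`), the
induction hypothesis transports `δ` to the return vertex, and the image-preserving one-level local
transport of brick (A⁺) (`exists_fixed_branch_transport_sameImage`) carries it back to `a`.  (The image
in `𝔾̃_j` of such a path is a «balloon» — a closed walk in a tree; abc-iut-f-176 gen 4's desk LEMMA
«balloons normalise», HOME/staging/f/f-176/g4/FINDING-core-bouquet.md §3, in tree-system form.)

Honest framing: the ∀-closures F-2773 / F-1732 are NOT claimed; nothing here bears on [IUTchIII]
Cor. 3.12; typed ≠ proved elsewhere.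
-/

namespace Literature.AnabelianGeometry.SemiGraphs

namespace ProfiniteSemiGraph

namespace GaloisLevelData

open CategoryTheory Topology

universe u

variable {𝒢 : ProfiniteSemiGraph.{u}} (D : GaloisLevelData 𝒢) (h𝒢 : 𝒢.IsCountable)

/-- Base vertices along the tree transitions: `proj_n (x) = proj_j (treeTrans x)`.
[cite: MochizukiSemiAnbd2006, Thm 3.7(iii) p.41] -/
theorem treeProj_vertexMap_eq_treeProj_treeTrans {j n : ℕ} (h : j ≤ n) (x : (D.tree n).Vertex) :
    (D.treeProj n).vertexMap x = (D.treeProj j).vertexMap ((D.treeTrans h).vertexMap x) := by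
  have e := congrArg (fun φ => SemiGraph.Hom.vertexMap φ x) (D.treeTrans_over h)
  simpa only [SemiGraph.comp_vertexMap, Function.comp_apply] using e.symm

/-- Base branches along the tree transitions: `proj_n (β) = proj_j (treeTrans β)`.
[cite: MochizukiSemiAnbd2006, Thm 3.7(iii) p.41] -/
theorem treeProj_branchMap_eq_treeProj_treeTrans {j n : ℕ} (h : j ≤ n) (β : (D.tree n).Branch) :
    (D.treeProj n).branchMap β = (D.treeProj j).branchMap ((D.treeTrans h).branchMap β) := by
  have e := congrArg (fun φ => SemiGraph.Hom.branchMap φ β) (D.treeTrans_over h)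
  simpa only [SemiGraph.comp_branchMap, Function.comp_apply] using e.symm

/-- **CROSS-LEVEL PATH TRANSPORT** (see the file header): along a `C`-fixed path of `𝔾̃_n` from `a` to
`z`, two vertices with the same image in `𝔾̃_j` (`j ≤ n`), a `C`-fixed branch at `z` is transported to a
`C`-fixed branch at `a` with the same image in `𝔾̃_j` — all edge groups topologically cyclic, NO
hypothesis on `𝔾`. [cite: MochizukiSemiAnbd2006, Thm 3.7(iii) p.41] -/
theorem exists_fixed_branch_of_sameImage_path {j n : ℕ} (hjn : j ≤ n) (C : Subgroup (D.temperedPi h𝒢))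
    (hcyc : ∀ e : 𝒢.graph.Edge, ∃ t₀ : 𝒢.Ge e, (Subgroup.zpowers t₀).topologicalClosure = ⊤)
    {w : 𝒢.graph.Vertex} (P₀ : D.PointSeq h𝒢 w) {a z : (D.tree n).Vertex}
    (haw : (D.treeProj n).vertexMap a = w)
    (haz : (D.treeTrans hjn).vertexMap a = (D.treeTrans hjn).vertexMap z)
    (p : (D.tree n).subdivision.Walk (Sum.inl a) (Sum.inl z)) (hp : p.IsPath)
    (hfix : ∀ x ∈ p.support, ∀ g ∈ C, SemiGraph.nodeMap (D.treeAct h𝒢 n g) x = x)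
    (δ : (D.tree n).Branch) (hδ : (D.tree n).abuts δ = some z)
    (hδfix : ∀ g ∈ C, (D.treeAct h𝒢 n g).hom.edgeMap ((D.tree n).edgeOf δ) = (D.tree n).edgeOf δ) :
    ∃ α : (D.tree n).Branch, (D.tree n).abuts α = some a ∧
      (D.treeTrans hjn).branchMap α = (D.treeTrans hjn).branchMap δ ∧
      ∀ g ∈ C, (D.treeAct h𝒢 n g).hom.edgeMap ((D.tree n).edgeOf α) = (D.tree n).edgeOf α := by
  classical
  obtain ⟨N, hN⟩ : ∃ N, p.length = N := ⟨_, rfl⟩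
  induction N using Nat.strong_induction_on generalizing a p with
  | _ N ih =>
  rcases Nat.eq_zero_or_pos N with hN0 | hNpos
  · -- the trivial path: `a = z`
    subst hN0
    have haz' : (Sum.inl a : (D.tree n).Node) = Sum.inl z := SimpleGraph.Walk.eq_of_length_eq_zero hN
    have haz'' : a = z := Sum.inl_injective haz'
    subst haz''
    exact ⟨δ, hδ, rfl, hδfix⟩
  -- a fixed branch-point gives a fixed edge
  have hfixE : ∀ β : (D.tree n).Branch, (Sum.inr (Sum.inr β) : (D.tree n).Node) ∈ p.support →
      ∀ g ∈ C, (D.treeAct h𝒢 n g).hom.edgeMap ((D.tree n).edgeOf β) = (D.tree n).edgeOf β := by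
    intro β hβ g hg
    have h := hfix _ hβ g hg
    simp only [SemiGraph.nodeMap_inr_inr, Sum.inr.injEq] at h
    rw [← (D.treeAct h𝒢 n g).hom.edgeOf_branchMap β, h]
  have hlen : 0 < p.length := hN ▸ hNpos
  -- the image vertex `ā` at level `j`
  set abar : (D.tree j).Vertex := (D.treeTrans hjn).vertexMap a with habar
  -- the first step of `p`: a branch `β₁` at `a`
  have hadj₁ := p.adj_getVert_succ (i := 0) hlen
  rw [SimpleGraph.Walk.getVert_zero] at hadj₁
  obtain ⟨β₁, hβ₁a, hβ₁⟩ := ((D.tree n).subdivision_adj_inl_iff a _).mp hadj₁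
  -- the first return to a vertex with image `ā`
  have hex : ∃ i, 0 < i ∧ i ≤ p.length ∧ ∃ u : (D.tree n).Vertex, p.getVert i = Sum.inl u ∧
      (D.treeTrans hjn).vertexMap u = abar :=
    ⟨p.length, hlen, le_rfl, z, p.getVert_length, haz.symm⟩
  set i₀ := Nat.find hex with hi₀
  obtain ⟨hi₀pos, hi₀le, u₀, hu₀, hu₀w⟩ := Nat.find_spec hex
  rw [← hi₀] at hi₀pos hi₀le hu₀
  simp only [Nat.zero_add] at hadj₁ hβ₁
  have hmin : ∀ i, 0 < i → i < i₀ → ∀ u : (D.tree n).Vertex, p.getVert i = Sum.inl u →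
      (D.treeTrans hjn).vertexMap u ≠ abar := by
    intro i hi hii u hiu huw
    exact Nat.find_min hex hii ⟨hi, (le_of_lt hii).trans hi₀le, u, hiu, huw⟩
  have hi₀two : 2 ≤ i₀ := by
    rcases Nat.lt_or_ge i₀ 2 with h | h
    · exfalso
      have h1 : i₀ = 1 := by omega
      rw [h1, hβ₁] at hu₀
      simp at hu₀
    · exact h
  -- the arriving branch `β_r` at `u₀`
  have hadjr := p.adj_getVert_succ (i := i₀ - 1) (by omega)
  rw [show i₀ - 1 + 1 = i₀ by omega, hu₀] at hadjr
  obtain ⟨βr, hβru₀, hβr⟩ := ((D.tree n).subdivision_adj_inl_iff u₀ _).mp hadjr.symm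
  -- base vertex of `u₀`
  have hu₀base : (D.treeProj n).vertexMap u₀ = w := by
    rw [D.treeProj_vertexMap_eq_treeProj_treeTrans hjn, hu₀w, habar,
      ← D.treeProj_vertexMap_eq_treeProj_treeTrans hjn, haw]
  -- image branches at level `j`
  have hb₁w : (D.tree j).abuts ((D.treeTrans hjn).branchMap β₁) = some abar := by
    rw [(D.treeTrans hjn).abuts_branchMap β₁ a hβ₁a]
  have hbrw : (D.tree j).abuts ((D.treeTrans hjn).branchMap βr) = some abar := by
    rw [(D.treeTrans hjn).abuts_branchMap βr u₀ hβru₀, hu₀w]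
  -- KEY: the first return is through the image branch of the first step (the tree `𝔾̃_j`)
  have hkey : (D.treeTrans hjn).branchMap βr = (D.treeTrans hjn).branchMap β₁ := by
    let Φ : (D.tree n).subdivision →g (D.tree j).subdivision :=
      ⟨Sum.map (D.treeTrans hjn).vertexMap (Sum.map (D.treeTrans hjn).edgeMap (D.treeTrans hjn).branchMap),
        fun h => SemiGraph.subdivision_adj_map (D.treeTrans hjn) h⟩
    let W := p.map Φ
    have hWv : ∀ i, W.getVert i = Φ (p.getVert i) := fun i => SimpleGraph.Walk.getVert_map Φ p i
    let W₁ := (W.drop 1).take (i₀ - 2)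
    have hstart : W.getVert 1 = Sum.inr (Sum.inr ((D.treeTrans hjn).branchMap β₁)) := by
      rw [hWv, hβ₁]; rfl
    have hend : (W.drop 1).getVert (i₀ - 2) = Sum.inr (Sum.inr ((D.treeTrans hjn).branchMap βr)) := by
      rw [SimpleGraph.Walk.drop_getVert, show 1 + (i₀ - 2) = i₀ - 1 by omega, hWv, hβr]; rfl
    let W₁' : (D.tree j).subdivision.Walk (Sum.inr (Sum.inr ((D.treeTrans hjn).branchMap β₁)))
        (Sum.inr (Sum.inr ((D.treeTrans hjn).branchMap βr))) := W₁.copy hstart hend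
    have havoid : (Sum.inl abar : (D.tree j).Node) ∉ W₁'.support := by
      intro hw
      rw [SimpleGraph.Walk.support_copy] at hw
      obtain ⟨m, hm, hmle⟩ := SimpleGraph.Walk.mem_support_iff_exists_getVert.mp hw
      rw [SimpleGraph.Walk.take_getVert, SimpleGraph.Walk.drop_getVert, hWv] at hm
      have hmle' : m ≤ i₀ - 2 := by
        have := hmle
        rw [SimpleGraph.Walk.take_length] at this
        exact le_trans this (min_le_left _ _)
      rw [min_eq_right hmle'] at hm
      -- the node `p.getVert (1 + m)` maps to the point of `ā`: it is a vertex with image `ā`, too early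
      have hm' : Sum.map (D.treeTrans hjn).vertexMap
          (Sum.map (D.treeTrans hjn).edgeMap (D.treeTrans hjn).branchMap) (p.getVert (1 + m)) =
            Sum.inl abar := hm
      rcases hxc : p.getVert (1 + m) with u | e | c
      · rw [hxc] at hm'
        have hu : (D.treeTrans hjn).vertexMap u = abar := Sum.inl_injective hm'
        exact hmin (1 + m) (by omega) (by omega) u hxc hu
      · rw [hxc] at hm'; simp at hm'
      · rw [hxc] at hm'; simp at hm'
    exact (SemiGraph.branch_eq_of_walk_avoiding_vertex (D.isTree_tree j).isTree.isAcyclic hb₁w hbrw W₁'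
      havoid).symm
  -- base branches
  have hb₁base : 𝒢.graph.abuts ((D.treeProj n).branchMap β₁) = some w := by
    rw [(D.treeProj n).abuts_branchMap β₁ a hβ₁a, haw]
  have hβrb : (D.treeProj n).branchMap βr = (D.treeProj n).branchMap β₁ := by
    rw [D.treeProj_branchMap_eq_treeProj_treeTrans hjn, hkey, ← D.treeProj_branchMap_eq_treeProj_treeTrans hjn]
  -- the tail path from `u₀` to `z`: shorter, still `C`-fixed, same image ends
  let q : (D.tree n).subdivision.Walk (Sum.inl u₀) (Sum.inl z) := (p.drop i₀).copy hu₀ rfl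
  have hqlen : q.length < N := by
    rw [SimpleGraph.Walk.length_copy, SimpleGraph.Walk.drop_length]
    omega
  have hqsupp : ∀ x ∈ q.support, x ∈ p.support := by
    intro x hx
    rw [SimpleGraph.Walk.support_copy, SimpleGraph.Walk.drop_support_eq_support_drop_min] at hx
    exact List.drop_subset _ _ hx
  have hqpath : q.IsPath := by
    refine SimpleGraph.Walk.IsPath.mk' ?_
    rw [SimpleGraph.Walk.support_copy, SimpleGraph.Walk.drop_support_eq_support_drop_min]
    exact hp.support_nodup.sublist (List.drop_sublist _ _)
  have hu₀z : (D.treeTrans hjn).vertexMap u₀ = (D.treeTrans hjn).vertexMap z := by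
    rw [hu₀w]; exact haz
  obtain ⟨β'', hβ''u₀, hβ''img, hβ''fix⟩ :=
    ih q.length hqlen hu₀base hu₀z q hqpath (fun x hx => hfix x (hqsupp x hx)) rfl
  -- the image-preserving local transport at `w` from `u₀` back to `a`
  obtain ⟨t₀, ht₀⟩ := hcyc (𝒢.graph.edgeOf ((D.treeProj n).branchMap β₁))
  have hδbase : 𝒢.graph.abuts ((D.treeProj n).branchMap β'') = some w := by
    rw [(D.treeProj n).abuts_branchMap β'' u₀ hβ''u₀, hu₀base]
  have hβ₁mem : (Sum.inr (Sum.inr β₁) : (D.tree n).Node) ∈ p.support := by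
    rw [← hβ₁]; exact p.getVert_mem_support 1
  have hβrmem : (Sum.inr (Sum.inr βr) : (D.tree n).Node) ∈ p.support := by
    rw [← hβr]; exact p.getVert_mem_support (i₀ - 1)
  obtain ⟨α, hαa, -, hαimg, hαfix⟩ := D.exists_fixed_branch_transport_sameImage h𝒢 hjn C P₀ hb₁base hδbase
    t₀ ht₀ haw hu₀base β₁ βr β'' hβ₁a rfl hβru₀ hβrb hβ''u₀ rfl hkey.symm (hfixE β₁ hβ₁mem)
    (hfixE βr hβrmem) hβ''fix
  exact ⟨α, hαa, hαimg.trans hβ''img, hαfix⟩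

end GaloisLevelData

end ProfiniteSemiGraph

end Literature.AnabelianGeometry.SemiGraphs
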